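import Mathlib
import Literature.Computability.Complexity.AOWTraceWalks
import Summits.PneNP.PneNP.Theorems.SfmBlSignAveraging

/-!
# The multilinear closed-walk expansion of `tr(A_{R,T}^{2(q+1)})` and its sum over the completions of a
prefix — line «sfm-bl» (MACHINE-PLAN M3: the SPEC of the walk enumerator; PROOF-SFM-BL §3 COMPUTABILITY)

FRONTIER F-N1c; nothing here bears on P vs NP.

Setting (the leg model of `SfmBlLegModel` / `SfmBlAssembly`): left pieces `α`, right pieces `β`, legs `e : Λ`
with endpoints `src e : α`, `dst e : β` and OUTPUT `out e : Fin m`; one sign per output, `χ = CandCutNorm.boolSign`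
cast to `ℝ` (`true ↦ −1`).  For a signing `T : Fin m → Bool` and a `T`-independent leg weight `w : Λ → ℝ`
(downstream: the indicator of the sparse remainder `R`) the signed biadjacency is
`M_T i k = Σ_{e : src e = i, dst e = k} w e · χ(T (out e))` (hypothesis `hM`) and `A_T := fromBlocks 0 M_T M_Tᵀ 0`.

* `trace_fromBlocks_pow_eq_two_mul` — `tr(A^{2(q+1)}) = 2·tr((MᵀM)^{q+1})` (block-diagonal square + cyclicity).
* `trace_pow_eq_leg_sum` — the MULTILINEAR EXPANSION: with the label expansion
  `Literature.Computability.Complexity.trace_pow_fiberMatrix` (Allen–O'Donnell–Witmer trace method, in tree),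
  `tr(A_T^{2(q+1)}) = 2·Σ_{L,L' : Fin (q+1) → Λ} [IsAdmissible src dst L L'] (Π_j w(L j)·w(L' j)) · Π_{i} χ(T i)^{μ i}`,
  where `μ i = #{j : out (L j) = i} + #{j : out (L' j) = i}` is the number of uses of output `i` by the closed
  leg-walk `(L 0, L' 0, L 1, L' 1, …)` (`L j, L' j` share their left piece; `L' j, L (j+1)` share their right piece).
* `sum_cylinder_trace_pow_eq` — summed over the CYLINDER `{T : ∀ i ∈ P, T i = T₀ i}` (the completions of a
  prefix assignment), by `SfmBl.sum_filter_prod_boolSign_pow`: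
  `Σ_{T ⊇ T₀|P} tr(A_T^{2(q+1)}) = 2·Σ_{L,L'} [adm] (Π_j w(L j)w(L' j)) · (Π_{i∈P} χ(T₀ i)^{μ i}) · Π_{i∉P} (2·[μ i even])`.
* `sum_cylinder_trace_pow_eq_parts` — the same in the EXACT SHAPE of `SfmBl.cutCertified_of_greedy`
  (legs `Fin m × Fin 3`, `out = Prod.fst`, part labelling `p`, remainder = `p e = none`):
  `Σ_{T ⊇ T₀|P} tr(A_{R,T}^{2(q+1)}) = 2·Σ_{L,L'} [adm ∧ all legs in R] (Π_{i∈P} χ(T₀ i)^{μ i}) · Π_{i∉P} (2·[μ i even])`,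
  and `prod_even_indicator` turns the last factor into `2^{#Pᶜ}·[∀ i ∉ P, μ i even]`.

This is the integer the sfm-bl machine must compute at every greedy step (MACHINE-PLAN §3 M3): enumerate the
admissible pairs `(L, L')` of remainder legs by ADJACENCY (each next leg shares the required piece with the
previous one: `≤ L` choices per step, `|R|·L^{2q+1}` candidates — polynomial because `L = 2^60` is a constant),
keep those whose free outputs are all used an even number of times, and add `± 2^{#Pᶜ+1}` according to the
parity of the number of uses of fixed outputs `i ∈ P` with `T₀ i = true`.  Definition-free.
-/

namespace Summit.PneNP.PneNP.Theorems.SfmBl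

open Matrix Finset BigOperators
open Literature.Computability.Complexity (fiberMatrix IsAdmissible trace_pow_fiberMatrix)

-- universe-0 index types, matching `SfmBlCutFromTrace` / `SfmBlAssembly` and `AOWTraceWalks`.
variable {α β : Type} [Fintype α] [Fintype β] [DecidableEq α] [DecidableEq β]

/-! ### Block-matrix algebra: `tr(A^{2(q+1)}) = 2·tr((MᵀM)^{q+1})` -/

/-- The square of the bipartite symmetrisation is block diagonal: `A² = fromBlocks (MMᵀ) 0 0 (MᵀM)`. -/
theorem fromBlocks_transpose_sq (M : Matrix α β ℝ) :
    (Matrix.fromBlocks 0 M Mᵀ 0) ^ 2 = Matrix.fromBlocks (M * Mᵀ) 0 0 (Mᵀ * M) := by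
  rw [sq, Matrix.fromBlocks_multiply]
  simp

/-- `tr(A^{2q}) = tr((MMᵀ)^q) + tr((MᵀM)^q)` (block-diagonal even powers; the trace of a block matrix is the
sum of the traces of its diagonal blocks, cf. `trace_fromBlocks'` in `Literature.Barriers.ValiantsHypothesis`). -/
theorem trace_fromBlocks_pow_two_mul (M : Matrix α β ℝ) (q : ℕ) :
    ((Matrix.fromBlocks 0 M Mᵀ 0) ^ (2 * q)).trace
      = ((M * Mᵀ) ^ q).trace + ((Mᵀ * M) ^ q).trace := by
  rw [pow_mul, fromBlocks_transpose_sq, Matrix.fromBlocks_diagonal_pow]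
  simp only [Matrix.trace, Matrix.diag, Fintype.sum_sum_type, Matrix.fromBlocks_apply₁₁,
    Matrix.fromBlocks_apply₂₂]

/-- `(MMᵀ)^{q+1} = M·(MᵀM)^q·Mᵀ`. -/
theorem pow_mul_transpose_succ (M : Matrix α β ℝ) (q : ℕ) :
    (M * Mᵀ) ^ (q + 1) = M * (Mᵀ * M) ^ q * Mᵀ := by
  induction q with
  | zero => rw [pow_one, pow_zero, Matrix.mul_one]
  | succ q ih =>
    rw [pow_succ, ih, pow_succ]
    simp only [Matrix.mul_assoc]

/-- Cyclicity: `tr((MMᵀ)^{q+1}) = tr((MᵀM)^{q+1})`. -/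
theorem trace_pow_mul_transpose (M : Matrix α β ℝ) (q : ℕ) :
    ((M * Mᵀ) ^ (q + 1)).trace = ((Mᵀ * M) ^ (q + 1)).trace := by
  rw [pow_mul_transpose_succ, Matrix.trace_mul_cycle, ← pow_succ']

/-- `tr((fromBlocks 0 M Mᵀ 0)^{2(q+1)}) = 2·tr((MᵀM)^{q+1})`. -/
theorem trace_fromBlocks_pow_eq_two_mul (M : Matrix α β ℝ) (q : ℕ) :
    ((Matrix.fromBlocks 0 M Mᵀ 0) ^ (2 * (q + 1))).trace = 2 * ((Mᵀ * M) ^ (q + 1)).trace := by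
  rw [trace_fromBlocks_pow_two_mul, trace_pow_mul_transpose, two_mul]

/-! ### The multilinear (closed leg-walk) expansion -/

variable {Λ : Type} [Fintype Λ] [DecidableEq Λ] {m : ℕ}

omit [Fintype α] [Fintype β] [DecidableEq Λ] in
/-- A matrix given entrywise by leg sums is the fiber matrix of `AOWTraceWalks`. -/
theorem eq_fiberMatrix (src : Λ → α) (dst : Λ → β) (g : Λ → ℝ) (M : Matrix α β ℝ)
    (hM : ∀ i k, M i k = ∑ e ∈ Finset.univ.filter (fun e => src e = i ∧ dst e = k), g e) :
    M = fiberMatrix src dst g := by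
  ext i k
  simp only [fiberMatrix, Matrix.of_apply]
  rw [hM, Finset.sum_filter]

/-- Regrouping a product along a map by fibres: `Π_j f (g j) = Π_i f i ^ #{j : g j = i}`. -/
theorem prod_comp_eq_prod_pow_card {n : ℕ} (f : Fin m → ℝ) (g : Fin n → Fin m) :
    ∏ j, f (g j) = ∏ i, f i ^ (Finset.univ.filter (fun j => g j = i)).card := by
  rw [← Finset.prod_fiberwise' Finset.univ g f]
  exact Finset.prod_congr rfl fun i _ => Finset.prod_const _

/-- THE MULTILINEAR EXPANSION of `tr(A_T^{2(q+1)})` for the output-shared-sign biadjacency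
`M_T i k = Σ_{e : src e = i, dst e = k} w e · χ(T (out e))`:
`tr(A_T^{2(q+1)}) = 2·Σ_{L,L'} [IsAdmissible src dst L L'] (Π_j w(L j)·w(L' j)) · Π_i χ(T i)^{μ i}`,
`μ i = #{j : out (L j) = i} + #{j : out (L' j) = i}`. -/
theorem trace_pow_eq_leg_sum (src : Λ → α) (dst : Λ → β) (out : Λ → Fin m) (w : Λ → ℝ)
    (T : Fin m → Bool) (M : Matrix α β ℝ)
    (hM : ∀ i k, M i k = ∑ e ∈ Finset.univ.filter (fun e => src e = i ∧ dst e = k),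
      w e * ((CandCutNorm.boolSign (T (out e)) : ℤ) : ℝ)) (q : ℕ) :
    ((Matrix.fromBlocks 0 M Mᵀ 0) ^ (2 * (q + 1))).trace
      = 2 * ∑ L : Fin (q + 1) → Λ, ∑ L' : Fin (q + 1) → Λ,
          if IsAdmissible src dst L L' then
            (∏ j, w (L j) * w (L' j)) *
              ∏ i : Fin m, (((CandCutNorm.boolSign (T i) : ℤ) : ℝ)) ^
                ((Finset.univ.filter (fun j => out (L j) = i)).card
                  + (Finset.univ.filter (fun j => out (L' j) = i)).card)
          else 0 := by
  rw [trace_fromBlocks_pow_eq_two_mul, eq_fiberMatrix src dst _ M hM, trace_pow_fiberMatrix]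
  congr 1
  refine Finset.sum_congr rfl fun L _ => Finset.sum_congr rfl fun L' _ => ?_
  split_ifs with h
  · -- regroup the weights and the signs
    set χ : Fin m → ℝ := fun i => ((CandCutNorm.boolSign (T i) : ℤ) : ℝ) with hχ
    have h1 : ∏ j, (w (L j) * χ (out (L j))) * (w (L' j) * χ (out (L' j)))
        = (∏ j, w (L j) * w (L' j)) * ((∏ j, χ (out (L j))) * ∏ j, χ (out (L' j))) := by
      rw [← Finset.prod_mul_distrib, ← Finset.prod_mul_distrib]
      exact Finset.prod_congr rfl fun j _ => by ring
    have h2 : ∏ j, χ (out (L j)) = ∏ i, χ i ^ (Finset.univ.filter (fun j => out (L j) = i)).card :=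
      prod_comp_eq_prod_pow_card χ (fun j => out (L j))
    have h3 : ∏ j, χ (out (L' j)) = ∏ i, χ i ^ (Finset.univ.filter (fun j => out (L' j) = i)).card :=
      prod_comp_eq_prod_pow_card χ (fun j => out (L' j))
    have h4 : (∏ i, χ i ^ (Finset.univ.filter (fun j => out (L j) = i)).card)
        * (∏ i, χ i ^ (Finset.univ.filter (fun j => out (L' j) = i)).card)
        = ∏ i, χ i ^ ((Finset.univ.filter (fun j => out (L j) = i)).card
            + (Finset.univ.filter (fun j => out (L' j) = i)).card) := by
      rw [← Finset.prod_mul_distrib]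
      exact Finset.prod_congr rfl fun i _ => (pow_add _ _ _).symm
    change ∏ j, (w (L j) * χ (out (L j))) * (w (L' j) * χ (out (L' j))) = _
    rw [h1, h2, h3, h4]
  · rfl

/-! ### Summing over the completions of a prefix (the cylinder `{T : ∀ i ∈ P, T i = T₀ i}`) -/

/-- CYLINDER SUM OF THE REMAINDER TRACE (MACHINE-PLAN M3 spec): for `T`-independent leg weights `w`,
`Σ_{T : ∀ i ∈ P, T i = T₀ i} tr(A_T^{2(q+1)})
   = 2·Σ_{L,L'} [IsAdmissible src dst L L'] (Π_j w(L j)·w(L' j)) · (Π_{i ∈ P} χ(T₀ i)^{μ i}) · Π_{i ∈ Pᶜ} (2·[μ i even])`. -/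
theorem sum_cylinder_trace_pow_eq (src : Λ → α) (dst : Λ → β) (out : Λ → Fin m) (w : Λ → ℝ)
    (M : (Fin m → Bool) → Matrix α β ℝ)
    (hM : ∀ T i k, M T i k = ∑ e ∈ Finset.univ.filter (fun e => src e = i ∧ dst e = k),
      w e * ((CandCutNorm.boolSign (T (out e)) : ℤ) : ℝ))
    (q : ℕ) (P : Finset (Fin m)) (T₀ : Fin m → Bool) :
    ∑ T ∈ (Finset.univ : Finset (Fin m → Bool)).filter (fun T => ∀ i ∈ P, T i = T₀ i),
        ((Matrix.fromBlocks 0 (M T) (M T)ᵀ 0) ^ (2 * (q + 1))).trace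
      = 2 * ∑ L : Fin (q + 1) → Λ, ∑ L' : Fin (q + 1) → Λ,
          if IsAdmissible src dst L L' then
            (∏ j, w (L j) * w (L' j)) *
              ((∏ i ∈ P, (((CandCutNorm.boolSign (T₀ i) : ℤ) : ℝ)) ^
                  ((Finset.univ.filter (fun j => out (L j) = i)).card
                    + (Finset.univ.filter (fun j => out (L' j) = i)).card))
                * ∏ i ∈ Pᶜ, (if Even ((Finset.univ.filter (fun j => out (L j) = i)).card
                    + (Finset.univ.filter (fun j => out (L' j) = i)).card) then (2 : ℝ) else 0))
          else 0 := by
  rw [Finset.sum_congr rfl (fun T _ => trace_pow_eq_leg_sum src dst out w T (M T) (hM T) q),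
    ← Finset.mul_sum, Finset.sum_comm]
  congr 1
  refine Finset.sum_congr rfl fun L _ => ?_
  rw [Finset.sum_comm]
  refine Finset.sum_congr rfl fun L' _ => ?_
  split_ifs with h
  · rw [← Finset.mul_sum, sum_filter_prod_boolSign_pow]
  · exact Finset.sum_const_zero

/-- The free-output factor is a power of two or zero:
`Π_{i ∈ Pᶜ} (2·[μ i even]) = 2^{#Pᶜ}·[∀ i ∈ Pᶜ, μ i even]`. -/
theorem prod_even_indicator (P : Finset (Fin m)) (μ : Fin m → ℕ) :
    ∏ i ∈ Pᶜ, (if Even (μ i) then (2 : ℝ) else 0)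
      = if ∀ i ∈ Pᶜ, Even (μ i) then (2 : ℝ) ^ Pᶜ.card else 0 := by
  rw [Finset.prod_ite_zero, Finset.prod_const]
  split_ifs <;> rfl

/-- `χ(true) = −1` as a real number. -/
theorem boolSign_true_real : (((CandCutNorm.boolSign true : ℤ)) : ℝ) = -1 := by
  simp [CandCutNorm.boolSign]

/-- `χ(false) = 1` as a real number. -/
theorem boolSign_false_real : (((CandCutNorm.boolSign false : ℤ)) : ℝ) = 1 := by
  simp [CandCutNorm.boolSign]

/-- The fixed-output factor is a sign: `Π_{i ∈ P} χ(T₀ i)^{μ i} = (−1)^{Σ_{i ∈ P, T₀ i = true} μ i}` — the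
machine only needs the PARITY of the number of uses of the fixed outputs signed `true`. -/
theorem prod_boolSign_pow_eq_neg_one_pow (P : Finset (Fin m)) (T₀ : Fin m → Bool) (μ : Fin m → ℕ) :
    ∏ i ∈ P, (((CandCutNorm.boolSign (T₀ i) : ℤ) : ℝ)) ^ (μ i)
      = (-1 : ℝ) ^ (∑ i ∈ P.filter (fun i => T₀ i = true), μ i) := by
  rw [← Finset.prod_filter_mul_prod_filter_not P (fun i => T₀ i = true), ← Finset.prod_pow_eq_pow_sum]
  have h1 : ∏ i ∈ P.filter (fun i => T₀ i = true), (((CandCutNorm.boolSign (T₀ i) : ℤ) : ℝ)) ^ (μ i)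
      = ∏ i ∈ P.filter (fun i => T₀ i = true), (-1 : ℝ) ^ (μ i) :=
    Finset.prod_congr rfl fun i hi => by rw [(Finset.mem_filter.1 hi).2, boolSign_true_real]
  have h2 : ∏ i ∈ P.filter (fun i => ¬ T₀ i = true), (((CandCutNorm.boolSign (T₀ i) : ℤ) : ℝ)) ^ (μ i)
      = 1 :=
    Finset.prod_eq_one fun i hi => by
      have hf : T₀ i = false := by simpa using (Finset.mem_filter.1 hi).2
      rw [hf, boolSign_false_real, one_pow]
  rw [h1, h2, mul_one]

/-! ### The consumer shape of `SfmBl.cutCertified_of_greedy` (legs `Fin m × Fin 3`, remainder `p e = none`) -/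

omit [Fintype α] [Fintype β] in
/-- Bridge between the three-conjunct part filter of `SfmBlAssembly` (`src e = i ∧ dst e = k ∧ p e = none`)
and the weighted two-conjunct filter used above (weight = indicator of the remainder). -/
theorem sum_filter_part_eq_sum_filter_indicator {r : ℕ} (src : Fin m × Fin 3 → α)
    (dst : Fin m × Fin 3 → β) (p : Fin m × Fin 3 → Option (Fin r)) (T : Fin m → Bool) (i : α) (k : β) :
    ∑ e ∈ Finset.univ.filter (fun e : Fin m × Fin 3 => src e = i ∧ dst e = k ∧ p e = none),
        ((CandCutNorm.boolSign (T e.1) : ℤ) : ℝ)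
      = ∑ e ∈ Finset.univ.filter (fun e : Fin m × Fin 3 => src e = i ∧ dst e = k),
        (if p e = none then (1 : ℝ) else 0) * ((CandCutNorm.boolSign (T e.1) : ℤ) : ℝ) := by
  rw [Finset.sum_filter, Finset.sum_filter]
  refine Finset.sum_congr rfl fun e _ => ?_
  by_cases h1 : src e = i ∧ dst e = k
  · by_cases h2 : p e = none
    · simp [h1, h2]
    · simp [h1, h2]
  · have : ¬ (src e = i ∧ dst e = k ∧ p e = none) := fun h => h1 ⟨h.1, h.2.1⟩
    simp [h1, this]

/-- CYLINDER SUM OF THE REMAINDER TRACE IN THE SHAPE OF `SfmBl.cutCertified_of_greedy`: legs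
`e : Fin m × Fin 3` of output `e.1`, pieces `src e : α`, `dst e : β`, part labelling `p` with remainder
`p e = none` and remainder matrices `MR T i k = Σ_{e : src e = i, dst e = k, p e = none} χ(T e.1)` (the `hMp`
of the assembly at `c = none`).  Then for every prefix data `P, T₀` and every `q`,
`Σ_{T : ∀ i ∈ P, T i = T₀ i} tr((fromBlocks 0 (MR T) (MR T)ᵀ 0)^{2(q+1)})
  = 2·Σ_{L,L' : Fin (q+1) → legs} [IsAdmissible src dst L L' ∧ ∀ j, p (L j) = none ∧ p (L' j) = none]
      (Π_{i ∈ P} χ(T₀ i)^{μ i}) · Π_{i ∈ Pᶜ} (2·[μ i even])`,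
`μ i = #{j : (L j).1 = i} + #{j : (L' j).1 = i}`.  (With `2(q+1) = 2^{j+2}`, i.e. `q + 1 = 2^{j+1}`, this is
the `Σ_{T'} trR T'` of the greedy hypothesis.) -/
theorem sum_cylinder_trace_pow_eq_parts {r : ℕ} (src : Fin m × Fin 3 → α) (dst : Fin m × Fin 3 → β)
    (p : Fin m × Fin 3 → Option (Fin r)) (MR : (Fin m → Bool) → Matrix α β ℝ)
    (hMR : ∀ T i k, MR T i k = ∑ e ∈ Finset.univ.filter
      (fun e : Fin m × Fin 3 => src e = i ∧ dst e = k ∧ p e = none), ((CandCutNorm.boolSign (T e.1) : ℤ) : ℝ))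
    (q : ℕ) (P : Finset (Fin m)) (T₀ : Fin m → Bool) :
    ∑ T ∈ (Finset.univ : Finset (Fin m → Bool)).filter (fun T => ∀ i ∈ P, T i = T₀ i),
        ((Matrix.fromBlocks 0 (MR T) (MR T)ᵀ 0) ^ (2 * (q + 1))).trace
      = 2 * ∑ L : Fin (q + 1) → Fin m × Fin 3, ∑ L' : Fin (q + 1) → Fin m × Fin 3,
          if IsAdmissible src dst L L' ∧ (∀ j, p (L j) = none ∧ p (L' j) = none) then
            (∏ i ∈ P, (((CandCutNorm.boolSign (T₀ i) : ℤ) : ℝ)) ^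
                ((Finset.univ.filter (fun j => (L j).1 = i)).card
                  + (Finset.univ.filter (fun j => (L' j).1 = i)).card))
              * ∏ i ∈ Pᶜ, (if Even ((Finset.univ.filter (fun j => (L j).1 = i)).card
                  + (Finset.univ.filter (fun j => (L' j).1 = i)).card) then (2 : ℝ) else 0)
          else 0 := by
  have hM' : ∀ T i k, MR T i k = ∑ e ∈ Finset.univ.filter (fun e : Fin m × Fin 3 => src e = i ∧ dst e = k),
      (if p e = none then (1 : ℝ) else 0) * ((CandCutNorm.boolSign (T (e.1)) : ℤ) : ℝ) := by
    intro T i k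
    rw [hMR]
    exact sum_filter_part_eq_sum_filter_indicator src dst p T i k
  rw [sum_cylinder_trace_pow_eq src dst Prod.fst (fun e => if p e = none then (1 : ℝ) else 0) MR hM' q P T₀]
  congr 1
  refine Finset.sum_congr rfl fun L _ => Finset.sum_congr rfl fun L' _ => ?_
  -- the indicator weights collapse to the membership condition `∀ j, p (L j) = none ∧ p (L' j) = none`
  by_cases hadm : IsAdmissible src dst L L'
  · by_cases hall : ∀ j, p (L j) = none ∧ p (L' j) = none
    · have hw : ∏ j, ((if p (L j) = none then (1 : ℝ) else 0) * (if p (L' j) = none then (1 : ℝ) else 0))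
          = 1 :=
        Finset.prod_eq_one fun j _ => by rw [if_pos (hall j).1, if_pos (hall j).2, one_mul]
      rw [if_pos hadm, hw, one_mul, if_pos ⟨hadm, hall⟩]
    · obtain ⟨j, hj⟩ := not_forall.1 hall
      have hw : ∏ j, ((if p (L j) = none then (1 : ℝ) else 0) * (if p (L' j) = none then (1 : ℝ) else 0))
          = 0 := by
        refine Finset.prod_eq_zero (Finset.mem_univ j) ?_
        by_cases h1 : p (L j) = none
        · rw [if_pos h1, one_mul, if_neg (fun h2 => hj ⟨h1, h2⟩)]
        · rw [if_neg h1, zero_mul]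
      rw [if_pos hadm, hw, zero_mul, if_neg (fun h => hall h.2)]
  · rw [if_neg hadm, if_neg (fun h => hadm h.1)]

end Summit.PneNP.PneNP.Theorems.SfmBl
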